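import Mathlib.Analysis.SpecialFunctions.Log.Basic
import Mathlib.Analysis.SpecialFunctions.Exp
import Mathlib.Topology.UniformSpace.UniformConvergence
import Mathlib.Topology.MetricSpace.Pseudo.Lemmas

/-!
# `(1 - δa)^k → e^{-ax}` uniformly on compacts as `δ → 0⁺`, `kδ → x`

The elementary limit behind the passage from the discrete spectral representation
`(1-a)^{x/δ}` to the continuum kernel `e^{-ax}` (used in H. Duminil-Copin, K. K. Kozlowski,
P. Lammers, I. Manolescu, arXiv:2603.06268 (2026), Part II §1.2.3, proof of Lemma 34, Step 2:
"By working out an explicit expression for `f_n`, it is straightforward to see that `f_n` converges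
on every compact subset of `ℝ_{>0} × ℝ` to `χ_u`"). [DKLM2026SixVertexGFF]

* `abs_log_one_sub_add_le` — `|log(1-t) + t| ≤ 2t²` for `|t| ≤ 1/2`;
* **`tendstoUniformlyOn_one_sub_mul_pow`** — for `δ_i → 0` with `δ_i > 0` and `δ_i k_i → x`,
  `(1 - δ_i a)^{k_i} → e^{-ax}` uniformly for `|a| ≤ β`;
* `tendstoLocallyUniformlyOn_one_sub_mul_pow` — the locally uniform version on `ℝ`.

## References

* W. Rudin, *Principles of Mathematical Analysis*, 3rd ed., Thm. 3.31 (the limit defining `e`);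
  folklore uniform version. H. Duminil-Copin et al., arXiv:2603.06268, Part II §1.2.3.
  [DKLM2026SixVertexGFF]
-/

noncomputable section

open Filter Topology Set

namespace Literature.Analysis.SpecialFunctions

/-- **`|log(1-t) + t| ≤ 2t²` for `|t| ≤ 1/2`** (from `1 - 1/y ≤ log y ≤ y - 1`). [folklore] -/
theorem abs_log_one_sub_add_le {t : ℝ} (ht : |t| ≤ 1 / 2) : |Real.log (1 - t) + t| ≤ 2 * t ^ 2 := by
  have ht' := abs_le.1 ht
  have h1 : 0 < 1 - t := by linarith
  have hup : Real.log (1 - t) ≤ -t := by linarith [Real.log_le_sub_one_of_pos h1]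
  have hlow : 1 - (1 - t)⁻¹ ≤ Real.log (1 - t) := Real.one_sub_inv_le_log_of_pos h1
  have hinv : (1 - t)⁻¹ ≤ 1 + t + 2 * t ^ 2 := by
    rw [inv_eq_one_div, div_le_iff₀ h1]
    nlinarith [sq_nonneg t]
  rw [abs_le]
  constructor <;> nlinarith

/-- **`|eᵘ - eᵛ| ≤ 2 eᵛ |u - v|` for `|u - v| ≤ 1`.** [folklore] -/
theorem abs_exp_sub_exp_le {u v : ℝ} (h : |u - v| ≤ 1) : |Real.exp u - Real.exp v| ≤ 2 * Real.exp v * |u - v| := by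
  have h1 : Real.exp u - Real.exp v = Real.exp v * (Real.exp (u - v) - 1) := by
    rw [mul_sub, ← Real.exp_add, mul_one]; ring_nf
  rw [h1, abs_mul, abs_of_pos (Real.exp_pos v)]
  calc Real.exp v * |Real.exp (u - v) - 1| ≤ Real.exp v * (2 * |u - v|) := by
        gcongr; exact Real.abs_exp_sub_one_le h
    _ = 2 * Real.exp v * |u - v| := by ring

/-- **`(1 - δ_i a)^{k_i} → e^{-ax}` uniformly on `[-β, β]`** whenever `δ_i → 0`, `δ_i > 0`
(eventually) and `δ_i k_i → x` (folklore uniform version of the limit defining `e`).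
[cite: DKLM2026SixVertexGFF, Part II §1.2.3 (proof of Lemma 34, Step 2)] -/
theorem tendstoUniformlyOn_one_sub_mul_pow {ι : Type*} {l : Filter ι} {δ : ι → ℝ} {k : ι → ℕ} {x : ℝ}
    (hδ0 : ∀ᶠ i in l, 0 < δ i) (hδ : Tendsto δ l (𝓝 0)) (hk : Tendsto (fun i => δ i * k i) l (𝓝 x))
    {β : ℝ} (hβ : 0 < β) :
    TendstoUniformlyOn (fun i a => (1 - δ i * a) ^ k i) (fun a => Real.exp (-(a * x))) l (Icc (-β) β) := by
  rw [Metric.tendstoUniformlyOn_iff]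
  intro ε hε
  -- constants
  set M : ℝ := β * |x| with hM
  set L : ℝ := Real.exp M with hL
  have hL0 : 0 < L := Real.exp_pos _
  set θ : ℝ := min 1 (ε / (4 * L)) with hθ
  have hθ0 : 0 < θ := lt_min one_pos (by positivity)
  have hθ1 : θ ≤ 1 := min_le_left _ _
  have hθε : 2 * L * θ ≤ ε / 2 := by
    have : θ ≤ ε / (4 * L) := min_le_right _ _
    calc 2 * L * θ ≤ 2 * L * (ε / (4 * L)) := by gcongr
      _ = ε / 2 := by field_simp; ring
  -- eventual smallness of `δ` and of `|δ k - x|`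
  have e1 : ∀ᶠ i in l, |δ i| < min (1 / (2 * β)) (θ / (4 * (|x| + 1) * β ^ 2)) := by
    have h0 : (0 : ℝ) < min (1 / (2 * β)) (θ / (4 * (|x| + 1) * β ^ 2)) := lt_min (by positivity) (by positivity)
    exact (tendsto_order.1 ((tendsto_zero_iff_abs_tendsto_zero δ).1 hδ)).2 _ h0
  have e2 : ∀ᶠ i in l, |δ i * k i - x| < min 1 (θ / (2 * β)) := by
    have := (Metric.tendsto_nhds.1 hk) _ (lt_min one_pos (by positivity : (0 : ℝ) < θ / (2 * β)))
    simpa only [dist_eq_norm, Real.norm_eq_abs] using this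
  filter_upwards [hδ0, e1, e2] with i hi h1 h2 a ha
  have haβ : |a| ≤ β := abs_le.2 ⟨ha.1, ha.2⟩
  have h1a : |δ i| < 1 / (2 * β) := h1.trans_le (min_le_left _ _)
  have h1b : |δ i| < θ / (4 * (|x| + 1) * β ^ 2) := h1.trans_le (min_le_right _ _)
  rw [abs_of_pos hi] at h1a h1b
  -- `t = δ a` is small
  set t : ℝ := δ i * a with ht
  have htabs : |t| ≤ 1 / 2 := by
    rw [ht, abs_mul, abs_of_pos hi]
    calc δ i * |a| ≤ 1 / (2 * β) * β := by gcongr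
      _ = 1 / 2 := by field_simp
  have h1t : 0 < 1 - t := by linarith [(abs_le.1 htabs).2]
  -- `(1 - t)^k = exp (k log (1 - t))`
  have hpow : (1 - t) ^ k i = Real.exp (k i * Real.log (1 - t)) := by
    rw [← Real.log_pow, Real.exp_log (pow_pos h1t _)]
  -- the exponent is close to `-a x`
  have h2a : |δ i * k i - x| < 1 := h2.trans_le (min_le_left _ _)
  have h2b : |δ i * k i - x| < θ / (2 * β) := h2.trans_le (min_le_right _ _)
  have hkδ : δ i * k i ≤ |x| + 1 := by
    have := (abs_lt.1 h2a).2
    linarith [le_abs_self x]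
  have hexp : |k i * Real.log (1 - t) - -(a * x)| ≤ θ := by
    have hdec : k i * Real.log (1 - t) - -(a * x) = k i * (Real.log (1 - t) + t) + a * (x - δ i * k i) := by
      rw [ht]; ring
    rw [hdec]
    calc |k i * (Real.log (1 - t) + t) + a * (x - δ i * k i)|
        ≤ |k i * (Real.log (1 - t) + t)| + |a * (x - δ i * k i)| := abs_add_le _ _
      _ = k i * |Real.log (1 - t) + t| + |a| * |x - δ i * k i| := by
          rw [abs_mul, abs_mul, Nat.abs_cast]
      _ ≤ k i * (2 * t ^ 2) + β * (θ / (2 * β)) := by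
          gcongr
          · exact abs_log_one_sub_add_le htabs
          · rw [abs_sub_comm]; exact h2b.le
      _ = 2 * (δ i * k i) * δ i * a ^ 2 + θ / 2 := by rw [ht]; field_simp
      _ ≤ 2 * (|x| + 1) * δ i * β ^ 2 + θ / 2 := by
          refine add_le_add ?_ le_rfl
          have ha2 : a ^ 2 ≤ β ^ 2 := by nlinarith [abs_le.1 haβ, abs_nonneg a]
          calc 2 * (δ i * k i) * δ i * a ^ 2 ≤ 2 * (|x| + 1) * δ i * a ^ 2 := by gcongr
            _ ≤ 2 * (|x| + 1) * δ i * β ^ 2 := by gcongr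
      _ ≤ θ / 2 + θ / 2 := by
          refine add_le_add ?_ le_rfl
          calc 2 * (|x| + 1) * δ i * β ^ 2 = (2 * (|x| + 1) * β ^ 2) * δ i := by ring
            _ ≤ (2 * (|x| + 1) * β ^ 2) * (θ / (4 * (|x| + 1) * β ^ 2)) := by gcongr
            _ = θ / 2 := by field_simp; ring
      _ = θ := by ring
  -- conclude with the Lipschitz bound for `exp`
  rw [dist_eq_norm, Real.norm_eq_abs, hpow, abs_sub_comm]
  have hv : Real.exp (-(a * x)) ≤ L := by
    rw [hL]; apply Real.exp_le_exp.2
    calc -(a * x) ≤ |a * x| := neg_le_abs _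
      _ = |a| * |x| := abs_mul _ _
      _ ≤ β * |x| := by gcongr
  calc |Real.exp (k i * Real.log (1 - t)) - Real.exp (-(a * x))|
      ≤ 2 * Real.exp (-(a * x)) * |k i * Real.log (1 - t) - -(a * x)| := abs_exp_sub_exp_le (hexp.trans hθ1)
    _ ≤ 2 * L * θ := by gcongr
    _ ≤ ε / 2 := hθε
    _ < ε := by linarith

/-- **Locally uniform version**: `(1 - δ_i a)^{k_i} → e^{-ax}` locally uniformly in `a ∈ ℝ`.
[cite: DKLM2026SixVertexGFF, Part II §1.2.3 (proof of Lemma 34, Step 2)] -/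
theorem tendstoLocallyUniformlyOn_one_sub_mul_pow {ι : Type*} {l : Filter ι} {δ : ι → ℝ} {k : ι → ℕ} {x : ℝ}
    (hδ0 : ∀ᶠ i in l, 0 < δ i) (hδ : Tendsto δ l (𝓝 0)) (hk : Tendsto (fun i => δ i * k i) l (𝓝 x)) :
    TendstoLocallyUniformlyOn (fun i a => (1 - δ i * a) ^ k i) (fun a => Real.exp (-(a * x))) l univ := by
  rw [tendstoLocallyUniformlyOn_iff_forall_isCompact isOpen_univ]
  intro K _ hK
  obtain ⟨β, hβ⟩ := hK.isBounded.subset_closedBall 0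
  have hβ' : K ⊆ Icc (-(max β 1)) (max β 1) := by
    intro a ha
    have := hβ ha
    rw [Metric.mem_closedBall, dist_zero_right, Real.norm_eq_abs] at this
    exact ⟨by linarith [(abs_le.1 (this.trans (le_max_left β 1))).1], (abs_le.1 (this.trans (le_max_left β 1))).2⟩
  exact (tendstoUniformlyOn_one_sub_mul_pow hδ0 hδ hk (lt_max_of_lt_right one_pos)).mono hβ'

end Literature.Analysis.SpecialFunctions

end
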